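import Mathlib
import HarnessLib
import Literature.MathematicalPhysics.KineticTheory.VelocityFlipEmbeddedChainSteadyState
import Literature.Probability.Process.HarrisTheorem
import Summits.AtomisticToContinuum.FouriersLaw.Theorems.VanishingNoiseTransferVanishingNoiseBoundFlipMildContinuityLyapunov
import Summits.AtomisticToContinuum.FouriersLaw.Theorems.VanishingNoiseTransferVanishingNoiseBoundFlipMildContinuityHarris
import Summits.AtomisticToContinuum.FouriersLaw.Theorems.VanishingNoiseTransferVanishingNoiseBoundFlipMildContinuityFlow

/-!
# The two δ-uniform inputs of stub CONT: uniform Harris data for the embedded flip chain and the weighted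
continuity of the resolvent in the bath temperatures
(helper for stub CONT `stub_flipMildContinuity`, line `fekete-usc-one-length`, crux stmt-AtomisticToContinuum-11976)

`--supports stmt-AtomisticToContinuum-11976` helper file (crux `VanishingNoiseBound`, route `VanishingNoiseTransfer`,
line `fekete-usc-one-length`, stub CONT, wave 5). For `pinnedChain ω₂ lam β γ` (all parameters `> 0`), `N ≥ 2`:

* `flip_uniformHarris` — for a temperature range `[T_min, T_max] ⊂ (0, ∞)`, a weight `0 < θ < 1/T_max` and a rate
  `r > 0`: constants `γ₀ < 1`, `K₀`, `ᾱ ∈ (0,1)`, `β_h > 0` such that for ALL `T_L, T_R ∈ [T_min, T_max]` the resolvent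
  kernel `R_r` and the embedded flip chain `K = Q ∘ₖ R_r` (`VelocityFlipEmbeddedChain.lean`) satisfy the drift
  `R_r V, K V ≤ γ₀ V + K₀` (`V = e^{θH}`; `pinnedChain_resolvent_lyapunov_uniform'`, `…FlipMildContinuityLyapunov`) and
  Hairer–Mattingly's contraction `⦀Kφ⦀_{β_h} ≤ ᾱ⦀φ⦀_{β_h}` of the `d_{β_h}`-Lipschitz seminorm
  (`Harris.abs_integral_sub_integral_le` with its explicit constants; minorisation `flip_embedded_minorization_uniform`,
  `…FlipMildContinuityHarris`);
* `resolvent_continuous_temps_exp`, `resolvent_continuous_temps_weighted` — for `T > 0`, `r > 0`, a CONTINUOUS `f` with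
  `|f| ≤ e^{H/(4T)}` and `θ > 1/(4T)`: `sup_z e^{-θH(z)} |R_r f(z) − R⁰_r f(z)| → 0` as the bath temperatures tend to
  `(T, T)` (`R⁰_r` the resolvent at `(T, T)`): truncation of `f` + `resolvent_continuous_temps`
  (`…FlipMildContinuityFlow`) on energy sublevel sets, Lyapunov tails beyond;
* `helper_flipMildContinuityResolvent` — registered helper (notation-free restatement of
  `resolvent_continuous_temps_weighted`).

References: Hairer–Mattingly 2011; Cuneo–Eckmann–Hairer–Rey-Bellet 2018 §3; Bernardin–Olla 2011 §2.1.
-/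

noncomputable section

open MeasureTheory ProbabilityTheory Filter Topology Set Metric
open scoped NNReal ENNReal Topology
open Literature.MathematicalPhysics.KineticTheory.HeatConduction Literature.Probability.Process OscillatorChain

namespace Summit.AtomisticToContinuum.FouriersLaw.Theorems.VanishingNoiseBound

variable {ω₂ lam β γ : ℝ} {N : ℕ}

/-- `e^{θH(z)} ≤ R₀` forces `H(z) ≤ R₀/θ` (`θ > 0`, since `θH < e^{θH}`). [folklore] -/
theorem hamiltonian_le_of_exp_le {θ R₀ H : ℝ} (hθ : 0 < θ) (h : Real.exp (θ * H) ≤ R₀) : H ≤ R₀ / θ := by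
  rw [le_div_iff₀ hθ, mul_comm]
  have := Real.add_one_le_exp (θ * H)
  linarith

set_option maxHeartbeats 800000 in
/-- **Uniform Harris data for the embedded flip chain.** For `pinnedChain ω₂ lam β γ` (all parameters `> 0`),
`N ≥ 2`, a temperature range `0 < T_min ≤ T_max`, a weight `0 < θ < 1/T_max` and a rate `r > 0` there are
`γ₀ < 1`, `K₀`, `ᾱ ∈ (0, 1)` and `β_h > 0` such that for ALL bath temperatures `T_L, T_R ∈ [T_min, T_max]`, with
`V = (e^{θH}).toNNReal`, `R = R_r` the resolvent kernel and `K = Q ∘ₖ R` the embedded flip chain at `(T_L, T_R)`: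
(i) `∫⁻ V dR(z,·) ≤ γ₀ V(z) + K₀`; (ii) `∫⁻ V dK(z,·) ≤ γ₀ V(z) + K₀`; (iii) for every measurable `φ` and `M ≥ 0`,
`|φ(x) − φ(y)| ≤ M d(x,y)` for all `x, y` implies `|Kφ(x) − Kφ(y)| ≤ ᾱ M d(x,y)`, `d(x,y) = 2 + β_h V(x) + β_h V(y)`.
Constants: drift from `pinnedChain_resolvent_lyapunov_uniform'` (flip invariance of `H`), minorisation weight `α`
from `flip_embedded_minorization_uniform` on `{V ≤ R₀}`, `R₀ = 2K₀/(1−γ₀) + 1`, amplitudes in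
`[√(2γT_min), √(2γT_max)]`; then `β_h = α/(2(K₀+1))`, `ᾱ = (1 − α/2) ∨ γ₀ ∨ (2 + β_h R₀(γ₀ + 2K₀/R₀))/(2 + β_h R₀)`.
[cite: HairerMattingly2011, Theorem 1.3] -/
theorem flip_uniformHarris (hω : 0 < ω₂) (hl : 0 < lam) (hβ : 0 < β) (hγ : 0 < γ) (hN : 1 < N)
    {Tmin Tmax θ r : ℝ} (hTmin : 0 < Tmin) (hmm : Tmin ≤ Tmax) (hθ : 0 < θ) (hθ' : θ < 1 / Tmax) (hr : 0 < r) :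
    ∃ (γ₀ K₀ : ℝ≥0) (abar βh : ℝ), γ₀ < 1 ∧ 0 < abar ∧ abar < 1 ∧ 0 < βh ∧
      ∀ (T_L T_R : ℝ) (hTL : 0 < T_L) (hTR : 0 < T_R), Tmin ≤ T_L → T_L ≤ Tmax → Tmin ≤ T_R → T_R ≤ Tmax →
        (∀ z : PhaseSpace N,
          ∫⁻ y, ((Real.exp (θ * (pinnedChain ω₂ lam β γ).hamiltonian N y)).toNNReal : ℝ≥0∞)
              ∂((pinnedChainSemigroup hω hl.le hβ.le hγ.le (Nat.zero_lt_of_lt hN) hTL.le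
                  hTR.le).resolventKernel r z) ≤
            (γ₀ : ℝ≥0∞) * ((Real.exp (θ * (pinnedChain ω₂ lam β γ).hamiltonian N z)).toNNReal : ℝ≥0∞) + K₀) ∧
        (∀ z : PhaseSpace N,
          ∫⁻ y, ((Real.exp (θ * (pinnedChain ω₂ lam β γ).hamiltonian N y)).toNNReal : ℝ≥0∞)
              ∂((pinnedChainSemigroup hω hl.le hβ.le hγ.le (Nat.zero_lt_of_lt hN) hTL.le
                  hTR.le).embeddedFlipKernel r z) ≤
            (γ₀ : ℝ≥0∞) * ((Real.exp (θ * (pinnedChain ω₂ lam β γ).hamiltonian N z)).toNNReal : ℝ≥0∞) + K₀) ∧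
        (∀ φ : PhaseSpace N → ℝ, Measurable φ → ∀ M : ℝ, 0 ≤ M →
          (∀ x y, |φ x - φ y| ≤ M * (2 + βh * (Real.exp (θ * (pinnedChain ω₂ lam β γ).hamiltonian N x)).toNNReal +
              βh * (Real.exp (θ * (pinnedChain ω₂ lam β γ).hamiltonian N y)).toNNReal)) →
          ∀ x y, |∫ w, φ w ∂((pinnedChainSemigroup hω hl.le hβ.le hγ.le (Nat.zero_lt_of_lt hN) hTL.le
                  hTR.le).embeddedFlipKernel r x) -
              ∫ w, φ w ∂((pinnedChainSemigroup hω hl.le hβ.le hγ.le (Nat.zero_lt_of_lt hN) hTL.le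
                  hTR.le).embeddedFlipKernel r y)| ≤
            abar * M * (2 + βh * (Real.exp (θ * (pinnedChain ω₂ lam β γ).hamiltonian N x)).toNNReal +
              βh * (Real.exp (θ * (pinnedChain ω₂ lam β γ).hamiltonian N y)).toNNReal)) := by
  have hN0 : 0 < N := Nat.zero_lt_of_lt hN
  have hTmax : 0 < Tmax := hTmin.trans_le hmm
  set P := pinnedChain ω₂ lam β γ with hP
  set H : PhaseSpace N → ℝ := P.hamiltonian N with hH
  have hHc : Continuous H := pinnedChain_continuous_hamiltonian ω₂ lam β γ N
  let V : PhaseSpace N → ℝ≥0 := fun x => (Real.exp (θ * H x)).toNNReal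
  have hVc : Continuous V := continuous_real_toNNReal.comp (Real.continuous_exp.comp (continuous_const.mul hHc))
  have hVm : Measurable V := hVc.measurable
  have hVreal : ∀ x, ((V x : ℝ≥0) : ℝ) = Real.exp (θ * H x) := fun x => Real.coe_toNNReal _ (Real.exp_pos _).le
  have hVflip : ∀ (i : Fin N) (x : PhaseSpace N), ((V (momentumFlip i x) : ℝ≥0) : ℝ≥0∞) = V x := by
    intro i x; simp only [V, hH, OscillatorChain.hamiltonian_momentumFlip]
  -- (1) the uniform drift
  obtain ⟨γ₀, K₀, hγ₀1, hdriftR⟩ := pinnedChain_resolvent_lyapunov_uniform' (N := N) hω hl hβ hγ hN hTmax hθ hθ' hr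
  -- (2) the uniform minorisation on `{V ≤ R₀}`
  set R₀ : ℝ≥0 := 2 * K₀ / (1 - γ₀) + 1 with hR₀
  have h1γ : 0 < 1 - γ₀ := tsub_pos_of_lt hγ₀1
  have hR₀big : 2 * K₀ < (1 - γ₀) * R₀ := by
    rw [hR₀, mul_add, mul_div_cancel₀ _ h1γ.ne', mul_one]
    exact lt_add_of_pos_right _ h1γ
  set E : ℝ := (R₀ : ℝ) / θ with hE
  set cmin : ℝ := Real.sqrt (2 * γ * Tmin) with hcmin
  set cmax : ℝ := Real.sqrt (2 * γ * Tmax) with hcmax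
  have hc0 : 0 < cmin := Real.sqrt_pos.2 (by positivity)
  have hcle : cmin ≤ cmax := Real.sqrt_le_sqrt (by nlinarith [hγ.le])
  obtain ⟨α, hα, hminor⟩ := flip_embedded_minorization_uniform (N := N) hω hl.le hβ hγ hN0 hr E hc0 hcle
  -- (3) Hairer–Mattingly's explicit constants
  set βh : ℝ := α / (2 * (K₀ + 1)) with hβh
  have hα' : (0 : ℝ) < α := by exact_mod_cast hα
  have hK0 : (0 : ℝ) ≤ K₀ := K₀.coe_nonneg
  have hβh0 : 0 < βh := by positivity
  have hβK : βh * K₀ ≤ α / 2 := by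
    rw [hβh, div_mul_eq_mul_div, div_le_div_iff₀ (by positivity) (by positivity)]
    nlinarith
  have hα₀α : (α : ℝ) / 2 < α := by linarith
  set abar : ℝ := max (max (1 - α + α / 2) γ₀) ((2 + βh * R₀ * (γ₀ + 2 * K₀ / R₀)) / (2 + βh * R₀)) with habar
  refine ⟨γ₀, K₀, abar, βh, hγ₀1, Harris.contractionFactor_pos hβh0,
    Harris.contractionFactor_lt_one hγ₀1 hR₀big hα₀α hβh0, hβh0,
    fun T_L T_R hTL hTR hL1 hL2 hR1 hR2 => ?_⟩
  set Sg := pinnedChainSemigroup hω hl.le hβ.le hγ.le hN0 hTL.le hTR.le with hSg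
  set K := Sg.embeddedFlipKernel r with hKdef
  haveI hKM : IsMarkovKernel K := Sg.isMarkovKernel_embeddedFlipKernel hr
  have hdR : ∀ z, ∫⁻ y, (V y : ℝ≥0∞) ∂(Sg.resolventKernel r z) ≤ (γ₀ : ℝ≥0∞) * V z + K₀ := fun z =>
    hdriftR T_L T_R hTL hTR hL2 hR2 z
  have hdK : ∀ z, ∫⁻ y, (V y : ℝ≥0∞) ∂(K z) ≤ (γ₀ : ℝ≥0∞) * V z + K₀ := fun z => by
    rw [hKdef, Sg.lintegral_embeddedFlipKernel_of_invariant (W := fun y => (V y : ℝ≥0∞))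
      (measurable_coe_nnreal_ennreal.comp hVm) hVflip z]
    exact hdR z
  -- the minorisation at these temperatures
  have hamp : ∀ {Tb : ℝ}, Tmin ≤ Tb → Tb ≤ Tmax → cmin ≤ Real.sqrt (2 * γ * Tb) ∧ Real.sqrt (2 * γ * Tb) ≤ cmax :=
    fun h1 h2 => ⟨Real.sqrt_le_sqrt (by nlinarith [hγ.le]), Real.sqrt_le_sqrt (by nlinarith [hγ.le])⟩
  obtain ⟨ν, hν, hνmin⟩ := hminor T_L T_R hTL.le hTR.le (hamp hL1 hL2).1 (hamp hL1 hL2).2 (hamp hR1 hR2).1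
    (hamp hR1 hR2).2
  haveI := hν
  have hminK : ∀ x, V x ≤ R₀ → α • ν ≤ K x := by
    intro x hx
    refine hνmin x (hamiltonian_le_of_exp_le hθ ?_)
    rw [← hVreal]; exact_mod_cast hx
  refine ⟨hdR, hdK, fun φ hφm M hM hφ x y => ?_⟩
  exact Harris.abs_integral_sub_integral_le K hVm hγ₀1 hdK hR₀big hminK hβh0 hβK hφm hM hφ x y


/-- Two-sided truncation at level `n > 0` of a real function: `|f − (−n ∨ (f ∧ n))| ≤ f²/n`. [folklore] -/
theorem abs_sub_clamp_le {a n : ℝ} (hn : 0 < n) : |a - max (-n) (min a n)| ≤ a ^ 2 / n := by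
  rw [le_div_iff₀ hn]
  rcases le_or_gt a n with h1 | h1
  · rcases le_or_gt (-n) a with h2 | h2
    · rw [min_eq_left h1, max_eq_right h2, sub_self, abs_zero, zero_mul]; positivity
    · rw [min_eq_left h1, max_eq_left h2.le]
      rw [abs_of_neg (by linarith)]
      nlinarith
  · rw [min_eq_right h1.le, max_eq_right (by linarith)]
    rw [abs_of_pos (by linarith)]
    nlinarith

/-- The truncation is bounded by the level: `|−n ∨ (a ∧ n)| ≤ n` (`n ≥ 0`). [folklore] -/
theorem abs_clamp_le {a n : ℝ} (hn : 0 ≤ n) : |max (-n) (min a n)| ≤ n :=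
  abs_le.2 ⟨le_max_left _ _, max_le (by linarith) (min_le_right _ _)⟩

set_option maxHeartbeats 800000 in
/-- **The resolvent of an `e^{H/4T}`-bounded continuous observable is continuous in the bath temperatures at
`(T, T)`, uniformly on energy sublevel sets.** For `pinnedChain ω₂ lam β γ` (all parameters `> 0`), `N ≥ 2`, `T > 0`,
`r > 0`, a continuous `f` with `|f| ≤ e^{H/(4T)}`, an energy level `E` and `e > 0` there is `δ' > 0` such that for all
`T_L, T_R > 0` with `|T_b − T| < δ'` and all `z` with `H(z) ≤ E`, `|R_r f(z) − R⁰_r f(z)| ≤ e` (resolvent kernels at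
`(T_L, T_R)` and `(T, T)`). Truncate `f` at level `n` (error `≤ f²/n ≤ e^{H/2T}/n`, controlled by the temperature-uniform
resolvent Lyapunov bound at weight `1/(2T)`, `pinnedChain_resolvent_lyapunov_uniform'`) and apply
`resolvent_continuous_temps` to the bounded truncation. [cite: CuneoEckmannHairerReyBellet2018, §3.1 Cor. 3.4] -/
theorem resolvent_continuous_temps_exp (hω : 0 < ω₂) (hl : 0 < lam) (hβ : 0 < β) (hγ : 0 < γ) (hN : 1 < N)
    {T : ℝ} (hT : 0 < T) {r : ℝ} (hr : 0 < r) {f : PhaseSpace N → ℝ} (hf : Continuous f)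
    (hfb : ∀ z, |f z| ≤ Real.exp (1 / (4 * T) * (pinnedChain ω₂ lam β γ).hamiltonian N z)) (E : ℝ) {e : ℝ}
    (he : 0 < e) :
    ∃ δ' : ℝ, 0 < δ' ∧ ∀ (T_L T_R : ℝ) (hTL : 0 < T_L) (hTR : 0 < T_R), |T_L - T| < δ' → |T_R - T| < δ' →
      ∀ z : PhaseSpace N, (pinnedChain ω₂ lam β γ).hamiltonian N z ≤ E →
        |∫ y, f y ∂((pinnedChainSemigroup hω hl.le hβ.le hγ.le (Nat.zero_lt_of_lt hN) hTL.le hTR.le).resolventKernel r z) -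
            ∫ y, f y ∂((pinnedChainSemigroup hω hl.le hβ.le hγ.le (Nat.zero_lt_of_lt hN) hT.le hT.le).resolventKernel r z)|
          ≤ e := by
  have hN0 : 0 < N := Nat.zero_lt_of_lt hN
  set P := pinnedChain ω₂ lam β γ with hP
  set H : PhaseSpace N → ℝ := P.hamiltonian N with hH
  have hHc : Continuous H := pinnedChain_continuous_hamiltonian ω₂ lam β γ N
  have hH0 : ∀ x, 0 ≤ H x := fun x => pinnedChain_hamiltonian_nonneg hω.le hl.le hβ.le γ N x
  -- the Lyapunov bound at weight `θ₂ = 1/(2T)` for temperatures `≤ 3T/2`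
  set θ₂ : ℝ := 1 / (2 * T) with hθ₂
  have hθ₂0 : 0 < θ₂ := by positivity
  have hTm : 0 < 3 * T / 2 := by positivity
  have hθ₂' : θ₂ < 1 / (3 * T / 2) := by
    rw [hθ₂, div_lt_div_iff₀ (by positivity) hTm]; nlinarith
  obtain ⟨γ₂, K₂, hγ₂, hly⟩ := pinnedChain_resolvent_lyapunov_uniform' (N := N) hω hl hβ hγ hN hTm hθ₂0 hθ₂' hr
  let V : PhaseSpace N → ℝ≥0 := fun x => (Real.exp (θ₂ * H x)).toNNReal
  have hVm : Measurable V :=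
    (continuous_real_toNNReal.comp (Real.continuous_exp.comp (continuous_const.mul hHc))).measurable
  have hVreal : ∀ x, ((V x : ℝ≥0) : ℝ) = Real.exp (θ₂ * H x) := fun x => Real.coe_toNNReal _ (Real.exp_pos _).le
  have hfV : ∀ x, |f x| ≤ 0 + 1 * (V x : ℝ) := fun x => by
    rw [zero_add, one_mul, hVreal]
    refine (hfb x).trans (Real.exp_le_exp.2 (mul_le_mul_of_nonneg_right ?_ (hH0 x)))
    rw [hθ₂, div_le_div_iff₀ (by positivity) (by positivity)]; nlinarith
  have hf2V : ∀ x, f x ^ 2 ≤ (V x : ℝ) := fun x => by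
    rw [hVreal, ← sq_abs]
    have h1 := hfb x
    have h0 : 0 ≤ |f x| := abs_nonneg _
    calc |f x| ^ 2 ≤ (Real.exp (1 / (4 * T) * H x)) ^ 2 := pow_le_pow_left₀ h0 h1 2
      _ = Real.exp (θ₂ * H x) := by rw [← Real.exp_nat_mul, hθ₂]; congr 1; push_cast; ring
  -- the truncation level
  set A : ℝ := Real.exp (θ₂ * E) + K₂ with hA
  have hA0 : 0 < A := by positivity
  set n : ℝ := 3 * A / e + 1 with hn
  have hn0 : 0 < n := by positivity
  have hnA : A / n ≤ e / 3 := by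
    rw [div_le_div_iff₀ hn0 (by norm_num : (0 : ℝ) < 3), hn]
    have h1 : e * (3 * A / e + 1) = 3 * A + e := by field_simp
    nlinarith
  set fn : PhaseSpace N → ℝ := fun x => max (-n) (min (f x) n) with hfn
  have hfnc : Continuous fn := by rw [hfn]; fun_prop
  have hfnb : ∀ x, |fn x| ≤ n := fun x => abs_clamp_le hn0.le
  have hffn : ∀ x, |f x - fn x| ≤ (V x : ℝ) / n := fun x =>
    (abs_sub_clamp_le hn0).trans (div_le_div_of_nonneg_right (hf2V x) hn0.le)
  -- continuity of the resolvent of the truncation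
  obtain ⟨δ₀, hδ₀, hcont⟩ := resolvent_continuous_temps (N := N) hω hl.le hβ.le hγ.le hN0 hr hfnc hfnb E hT.le hT.le
    (by positivity : 0 < e / 3)
  refine ⟨min δ₀ (T / 2), lt_min hδ₀ (by positivity), fun T_L T_R hTL hTR hdL hdR z hz => ?_⟩
  have hdL' : |T_L - T| < δ₀ := hdL.trans_le (min_le_left _ _)
  have hdR' : |T_R - T| < δ₀ := hdR.trans_le (min_le_left _ _)
  have hLm : T_L ≤ 3 * T / 2 := by have := (abs_lt.1 (hdL.trans_le (min_le_right _ _))).2; linarith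
  have hRm : T_R ≤ 3 * T / 2 := by have := (abs_lt.1 (hdR.trans_le (min_le_right _ _))).2; linarith
  have hTm' : T ≤ 3 * T / 2 := by linarith
  -- the truncation errors under both resolvents
  have htrunc : ∀ (T₁ T₂ : ℝ) (h₁ : 0 < T₁) (h₂ : 0 < T₂), T₁ ≤ 3 * T / 2 → T₂ ≤ 3 * T / 2 →
      |∫ y, f y ∂((pinnedChainSemigroup hω hl.le hβ.le hγ.le hN0 h₁.le h₂.le).resolventKernel r z) -
        ∫ y, fn y ∂((pinnedChainSemigroup hω hl.le hβ.le hγ.le hN0 h₁.le h₂.le).resolventKernel r z)| ≤ e / 3 := by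
    intro T₁ T₂ h₁ h₂ h1m h2m
    set R := (pinnedChainSemigroup hω hl.le hβ.le hγ.le hN0 h₁.le h₂.le).resolventKernel r with hR
    haveI : IsMarkovKernel R := LangevinChainSemigroup.isMarkovKernel_resolventKernel _ hr
    have hlyz := hly T₁ T₂ h₁ h₂ h1m h2m z
    have hVR : ∫⁻ y, (V y : ℝ≥0∞) ∂(R z) ≠ ⊤ := ne_top_of_le_ne_top (by simp [ENNReal.mul_eq_top]) hlyz
    have hfi : Integrable f (R z) := Harris.integrable_of_abs_le_affine hVm hVR hf.measurable hfV
    have hfni : Integrable fn (R z) := Harris.integrable_of_abs_le_affine hVm hVR hfnc.measurable (A := n) (B := 0)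
      (fun x => by rw [zero_mul, add_zero]; exact hfnb x)
    have hVi : Integrable (fun y => (V y : ℝ)) (R z) := Harris.integrable_coe_of_lintegral_ne_top hVm hVR
    have hRbound : (∫⁻ y, (V y : ℝ≥0∞) ∂(R z)).toReal ≤ A := by
      have h1 : (∫⁻ y, (V y : ℝ≥0∞) ∂(R z)).toReal ≤ γ₂ * (V z : ℝ) + K₂ := by
        have htoReal : (((γ₂ : ℝ≥0∞) * V z + K₂)).toReal = γ₂ * (V z : ℝ) + K₂ := by
          rw [ENNReal.toReal_add (by simp [ENNReal.mul_eq_top]) ENNReal.coe_ne_top, ENNReal.toReal_mul]; simp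
        rw [← htoReal]; exact ENNReal.toReal_mono (by simp [ENNReal.mul_eq_top]) hlyz
      have h2 : (γ₂ : ℝ) * (V z : ℝ) ≤ 1 * Real.exp (θ₂ * E) := by
        rw [hVreal]
        refine mul_le_mul (by exact_mod_cast hγ₂.le) (Real.exp_le_exp.2 (mul_le_mul_of_nonneg_left hz hθ₂0.le))
          (Real.exp_pos _).le zero_le_one
      rw [hA]; linarith
    rw [← integral_sub hfi hfni]
    calc |∫ y, (f y - fn y) ∂(R z)| ≤ ∫ y, |f y - fn y| ∂(R z) := abs_integral_le_integral_abs
      _ ≤ ∫ y, (V y : ℝ) / n ∂(R z) := integral_mono (hfi.sub hfni).abs (hVi.div_const n) hffn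
      _ = (∫⁻ y, (V y : ℝ≥0∞) ∂(R z)).toReal / n := by
          rw [integral_div, Harris.integral_coe_eq_toReal hVm]
      _ ≤ A / n := div_le_div_of_nonneg_right hRbound hn0.le
      _ ≤ e / 3 := hnA
  have h1 := htrunc T_L T_R hTL hTR hLm hRm
  have h2 := htrunc T T hT hT hTm' hTm'
  have h3 := hcont T_L T_R hTL.le hTR.le hdL' hdR' z hz
  -- combine
  have key : ∀ a a' b b' : ℝ, |a - a'| ≤ e / 3 → |b - b'| ≤ e / 3 → |a' - b'| ≤ e / 3 → |a - b| ≤ e := by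
    intro a a' b b' ha hb hab
    have := abs_sub_le a a' b
    have := abs_sub_le a' b' b
    rw [abs_sub_comm b' b] at this
    linarith
  exact key _ _ _ _ h1 h2 h3

set_option maxHeartbeats 800000 in
/-- **Weighted-norm continuity of the resolvent in the bath temperatures at `(T, T)`.** Same setting as
`resolvent_continuous_temps_exp`; for a weight exponent `θ > 1/(4T)` and `e > 0` there is `δ' > 0` such that for all
`T_L, T_R > 0` with `|T_b − T| < δ'` and ALL `z`, `|R_r f(z) − R⁰_r f(z)| ≤ e · e^{θH(z)}`: on `{H ≤ E}` by
`resolvent_continuous_temps_exp`; for `H(z) > E` both terms are `≤ ∫ e^{H/4T} dR(z,·) ≤ e^{H(z)/4T} + K₁` (uniform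
resolvent Lyapunov bound at weight `1/(4T)`), which is `≤ (e/2) e^{θH(z)}` once `(θ − 1/4T)E ≥ 4/e` and `θE ≥ 4K₁/e`.
[cite: CuneoEckmannHairerReyBellet2018, §3.1 Cor. 3.4] -/
theorem resolvent_continuous_temps_weighted (hω : 0 < ω₂) (hl : 0 < lam) (hβ : 0 < β) (hγ : 0 < γ) (hN : 1 < N)
    {T : ℝ} (hT : 0 < T) {r : ℝ} (hr : 0 < r) {f : PhaseSpace N → ℝ} (hf : Continuous f)
    (hfb : ∀ z, |f z| ≤ Real.exp (1 / (4 * T) * (pinnedChain ω₂ lam β γ).hamiltonian N z)) {θ : ℝ}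
    (hθ : 1 / (4 * T) < θ) {e : ℝ} (he : 0 < e) :
    ∃ δ' : ℝ, 0 < δ' ∧ ∀ (T_L T_R : ℝ) (hTL : 0 < T_L) (hTR : 0 < T_R), |T_L - T| < δ' → |T_R - T| < δ' →
      ∀ z : PhaseSpace N,
        |∫ y, f y ∂((pinnedChainSemigroup hω hl.le hβ.le hγ.le (Nat.zero_lt_of_lt hN) hTL.le hTR.le).resolventKernel r z) -
            ∫ y, f y ∂((pinnedChainSemigroup hω hl.le hβ.le hγ.le (Nat.zero_lt_of_lt hN) hT.le hT.le).resolventKernel r z)|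
          ≤ e * Real.exp (θ * (pinnedChain ω₂ lam β γ).hamiltonian N z) := by
  have hN0 : 0 < N := Nat.zero_lt_of_lt hN
  set P := pinnedChain ω₂ lam β γ with hP
  set H : PhaseSpace N → ℝ := P.hamiltonian N with hH
  have hHc : Continuous H := pinnedChain_continuous_hamiltonian ω₂ lam β γ N
  have hH0 : ∀ x, 0 ≤ H x := fun x => pinnedChain_hamiltonian_nonneg hω.le hl.le hβ.le γ N x
  -- the Lyapunov bound at weight `θ₁ = 1/(4T)` for temperatures `≤ 3T/2`
  set θ₁ : ℝ := 1 / (4 * T) with hθ₁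
  have hθ₁0 : 0 < θ₁ := by positivity
  have hθ0 : 0 < θ := hθ₁0.trans hθ
  have hTm : 0 < 3 * T / 2 := by positivity
  have hθ₁' : θ₁ < 1 / (3 * T / 2) := by
    rw [hθ₁, div_lt_div_iff₀ (by positivity) hTm]; nlinarith
  obtain ⟨γ₁, K₁, hγ₁, hly⟩ := pinnedChain_resolvent_lyapunov_uniform' (N := N) hω hl hβ hγ hN hTm hθ₁0 hθ₁' hr
  let V : PhaseSpace N → ℝ≥0 := fun x => (Real.exp (θ₁ * H x)).toNNReal
  have hVm : Measurable V :=
    (continuous_real_toNNReal.comp (Real.continuous_exp.comp (continuous_const.mul hHc))).measurable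
  have hVreal : ∀ x, ((V x : ℝ≥0) : ℝ) = Real.exp (θ₁ * H x) := fun x => Real.coe_toNNReal _ (Real.exp_pos _).le
  have hfV : ∀ x, |f x| ≤ 0 + 1 * (V x : ℝ) := fun x => by rw [zero_add, one_mul, hVreal]; exact hfb x
  -- the bound `|R f(z)| ≤ e^{θ₁H(z)} + K₁` for temperatures `≤ 3T/2`
  have hRf : ∀ (T₁ T₂ : ℝ) (h₁ : 0 < T₁) (h₂ : 0 < T₂), T₁ ≤ 3 * T / 2 → T₂ ≤ 3 * T / 2 → ∀ z,
      |∫ y, f y ∂((pinnedChainSemigroup hω hl.le hβ.le hγ.le hN0 h₁.le h₂.le).resolventKernel r z)| ≤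
        Real.exp (θ₁ * H z) + K₁ := by
    intro T₁ T₂ h₁ h₂ h1m h2m z
    set R := (pinnedChainSemigroup hω hl.le hβ.le hγ.le hN0 h₁.le h₂.le).resolventKernel r with hR
    haveI : IsMarkovKernel R := LangevinChainSemigroup.isMarkovKernel_resolventKernel _ hr
    have hlyz := hly T₁ T₂ h₁ h₂ h1m h2m z
    have hVR : ∫⁻ y, (V y : ℝ≥0∞) ∂(R z) ≠ ⊤ := ne_top_of_le_ne_top (by simp [ENNReal.mul_eq_top]) hlyz
    have h1 := Harris.abs_integral_le_of_abs_le_affine hVm hVR hf.measurable hfV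
    rw [zero_mul, zero_add, one_mul] at h1
    refine h1.trans ?_
    have htoReal : (((γ₁ : ℝ≥0∞) * V z + K₁)).toReal = γ₁ * (V z : ℝ) + K₁ := by
      rw [ENNReal.toReal_add (by simp [ENNReal.mul_eq_top]) ENNReal.coe_ne_top, ENNReal.toReal_mul]; simp
    have h2 : (∫⁻ y, (V y : ℝ≥0∞) ∂(R z)).toReal ≤ γ₁ * (V z : ℝ) + K₁ := by
      rw [← htoReal]; exact ENNReal.toReal_mono (by simp [ENNReal.mul_eq_top]) hlyz
    have h3 : (γ₁ : ℝ) * (V z : ℝ) ≤ 1 * (V z : ℝ) :=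
      mul_le_mul_of_nonneg_right (by exact_mod_cast hγ₁.le) (V z).coe_nonneg
    rw [← hVreal]; linarith
  -- the energy level beyond which the tails are small
  set E : ℝ := max (4 / (e * (θ - θ₁))) (4 * K₁ / (e * θ)) with hE
  have hsub : 0 < θ - θ₁ := sub_pos.2 hθ
  have htail : ∀ z, E ≤ H z → 2 * (Real.exp (θ₁ * H z) + K₁) ≤ e * Real.exp (θ * H z) := by
    intro z hz
    have hK0 : (0 : ℝ) ≤ K₁ := K₁.coe_nonneg
    -- `e^{(θ-θ₁)H} ≥ (θ-θ₁)H ≥ (θ-θ₁)E ≥ 4/e`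
    have e1 : 4 / e ≤ Real.exp ((θ - θ₁) * H z) := by
      have h1 : 4 / (e * (θ - θ₁)) ≤ H z := (le_max_left _ _).trans hz
      rw [div_le_iff₀ (by positivity)] at h1
      have h2 := Real.add_one_le_exp ((θ - θ₁) * H z)
      rw [div_le_iff₀ he]
      nlinarith
    -- `e^{θH} ≥ θH ≥ θE ≥ 4K₁/e`
    have e2 : 4 * K₁ / e ≤ Real.exp (θ * H z) := by
      have h1 : 4 * K₁ / (e * θ) ≤ H z := (le_max_right _ _).trans hz
      rw [div_le_iff₀ (by positivity)] at h1
      have h2 := Real.add_one_le_exp (θ * H z)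
      rw [div_le_iff₀ he]
      nlinarith
    have e3 : Real.exp (θ * H z) = Real.exp (θ₁ * H z) * Real.exp ((θ - θ₁) * H z) := by
      rw [← Real.exp_add]; ring_nf
    have hpos₁ : 0 < Real.exp (θ₁ * H z) := Real.exp_pos _
    rw [div_le_iff₀ he] at e1 e2
    nlinarith [mul_le_mul_of_nonneg_left e1 hpos₁.le]
  -- the compact part
  obtain ⟨δ₀, hδ₀, hcomp⟩ := resolvent_continuous_temps_exp hω hl hβ hγ hN hT hr hf hfb E he
  refine ⟨min δ₀ (T / 2), lt_min hδ₀ (by positivity), fun T_L T_R hTL hTR hdL hdR z => ?_⟩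
  have hLm : T_L ≤ 3 * T / 2 := by have := (abs_lt.1 (hdL.trans_le (min_le_right _ _))).2; linarith
  have hRm : T_R ≤ 3 * T / 2 := by have := (abs_lt.1 (hdR.trans_le (min_le_right _ _))).2; linarith
  have hTm' : T ≤ 3 * T / 2 := by linarith
  have hexp1 : 1 ≤ Real.exp (θ * H z) := Real.one_le_exp (mul_nonneg hθ0.le (hH0 z))
  rcases le_or_gt (H z) E with hz | hz
  · refine (hcomp T_L T_R hTL hTR (hdL.trans_le (min_le_left _ _)) (hdR.trans_le (min_le_left _ _)) z hz).trans ?_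
    exact le_mul_of_one_le_right he.le hexp1
  · have h1 := hRf T_L T_R hTL hTR hLm hRm z
    have h2 := hRf T T hT hT hTm' hTm' z
    have h3 := htail z hz.le
    refine (abs_sub _ _).trans ?_
    linarith


/-! ## Registered helper -/

/-- Registered helper sub-goal `helper_flipMildContinuityResolvent` of stub `stub_flipMildContinuity` (line
`fekete-usc-one-length`, crux stmt-AtomisticToContinuum-11976): the weighted continuity of the resolvent in the bath
temperatures at `(T, T)` (`resolvent_continuous_temps_weighted`, notation-free one-line form). -/
theorem helper_flipMildContinuityResolvent : ∀ (ω₂ lam β γ : ℝ) (hω : 0 < ω₂) (hl : 0 < lam) (hβ : 0 < β) (hγ : 0 < γ) (N : ℕ) (hN : 1 < N) (T : ℝ) (hT : 0 < T) (r : ℝ), 0 < r → ∀ (f : Literature.MathematicalPhysics.KineticTheory.HeatConduction.PhaseSpace N → ℝ), Continuous f → (∀ z, |f z| ≤ Real.exp (1 / (4 * T) * (Literature.MathematicalPhysics.KineticTheory.HeatConduction.pinnedChain ω₂ lam β γ).hamiltonian N z)) → ∀ (θ : ℝ), 1 / (4 * T) < θ → ∀ (e : ℝ), 0 < e → ∃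 δ' : ℝ, 0 < δ' ∧ ∀ (T_L T_R : ℝ) (hTL : 0 < T_L) (hTR : 0 < T_R), |T_L - T| < δ' → |T_R - T| < δ' → ∀ z : Literature.MathematicalPhysics.KineticTheory.HeatConduction.PhaseSpace N, |MeasureTheory.integral ((Literature.MathematicalPhysics.KineticTheory.HeatConduction.pinnedChainSemigroup hω (le_of_lt hl) (le_of_lt hβ) (le_of_lt hγ) (Nat.zero_lt_of_lt hN) (le_of_lt hTL) (le_of_lt hTR)).resolventKernel r z) (fun y => f y) - MeasureTheory.integral ((Literature.MathematicalPhysics.KineticTheory.HeatConduction.pinnedChainSemigroup hω (le_of_lt hl) (le_of_lt hβ) (le_of_lt hγ) (Nat.zero_lt_of_lt hN) (le_of_lt hT) (le_of_lt hT)).resolventKernel r z) (fun y => f y)| ≤ e * Real.exp (θ * (Literature.MathematicalPhysics.KineticTheory.HeatConduction.pinnedChain ω₂ lam β γ).hamiltonian N z) :=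
  fun _ _ _ _ hω hl hβ hγ _ hN _ hT _ hr _ hf hfb _ hθ _ he =>
    resolvent_continuous_temps_weighted hω hl hβ hγ hN hT hr hf hfb hθ he

end Summit.AtomisticToContinuum.FouriersLaw.Theorems.VanishingNoiseBound

end
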